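import Summits.QuantumAdvantage.QuantumAdvantage.Theorems.RingPeriodFold

/-!
# RingPeriodFoldStrategies — covariant / equivariant strategies FOLD; descent, amplifier, «WLOG aperiodic» (lens 2 g7 «PeriodDial», part 2)

Support library, part 2 of 2 (part 1: `RingPeriodFold` — periodization `per m y` and the fold law `rel_per_per_iff`).  Sorry-free,
standard axioms; predicates are `Set`-valued (`perfectCov n`, `covLosing D`, `usablePeriods n₀ n`, `equivariant d n`, `losing D`) and
the laws carry their binders inline.  Contents: covariant rules `cov Q` / `covStrat Q` (degree kept: `covStrat_mem_lowDeg`) answer a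
periodic pattern by the periodization of their FOLD's answer (`foldQ`, `foldQ_mem_lowDeg` — no degree cost —, `cov_per`); DESCENT of
perfection `covPerfect_fold` / `covPerfect_descends` (`m` odd, `d ≥ 3`); AMPLIFIER `covNotPerfectAt_mul` (`d ∈ covLosing D → m·d ∈
covLosing D`); the law `covNotPerfect_iff_irr` (eventual covariant non-perfection need only be checked at lengths with no usable period);
`d`-EQUIVARIANT strategies fold too (`eqv_per_const`, `foldStrat`, `eqv_output_per`, `notPerfect_eqv_mul`) and the law
`notPerfect_iff_aperiodic` («WLOG aperiodic»: `∃ n₀, ∀ n ≥ n₀, n ∈ losing D` — for `D = 2` this is ExactnessDial's `NoPerfectTwo3`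
(stmt 27432) and `∀ D` it is `NoPerfectConst3` (stmt 27380), definitionally — iff the same with the strategies restricted to those
equivariant under NO usable period); the `decide` certificate `allOnes_perfect_three` (`3 ∉ covLosing D`: the 3-ring is solved on its
odd class by `z ≡ 1`) and `allOnes_valid_periodic`.  Cell decomp-qadv, lens 2 g7; not in print.
-/

noncomputable section

set_option linter.dupNamespace false

namespace Summit.QuantumAdvantage.QuantumAdvantage.Theorems.RingPeriodFold

open Finset Literature.Computability.QuantumComplexity Literature.Computability.QuantumComplexity.RingHLF
open Literature.Computability.MetaComplexity Literature.Computability.MetaComplexity.Smolensky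
open Summit.QuantumAdvantage.AdviceFreeQNC0

open scoped Classical

variable {m d : ℕ}

/-! ## §3 Covariant (rotation-equivariant) rules over `𝔽₃`, their FOLD, and the descent of perfection -/

/-- the rotation-COVARIANT ring rule generated by ONE polynomial `Q : CubeFn (ZMod 3) n`: `z_b(x) = [Q(rot_b x) = 1]`
(the `𝔽₃` twin of tree `eqvStrategy`, which is typed over `ZMod 2`; tree `rot`). -/
def cov {n : ℕ} (Q : CubeFn (ZMod 3) n) (x : Fin n → Bool) : Fin n → Bool := fun b => decide (Q (rot b.val x) = 1)

/-- the strategy (family of `n` polynomials `Q ∘ rot_b`) of a covariant rule. -/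
def covStrat {n : ℕ} (Q : CubeFn (ZMod 3) n) : Fin n → CubeFn (ZMod 3) n := fun b x => Q (rot b.val x)

/-- the covariant output is the indicator output of the covariant strategy. -/
theorem cov_eq_covStrat {n : ℕ} (Q : CubeFn (ZMod 3) n) (x : Fin n → Bool) :
    cov Q x = fun b => decide (covStrat Q b x = 1) := rfl

/-- a coordinate of a rotated pattern is a coordinate: degree `≤ 1` (any field; tree `ind_rot_mem` is the `ZMod 2` case). -/
theorem ind_rot_mem' {F : Type*} [Field F] {n : ℕ} (k : ℕ) (j : Fin n) :
    (fun u : Fin n → Bool => if rot k u j = true then (1 : F) else 0) ∈ lowDeg F n 1 := by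
  have e : (fun u : Fin n → Bool => if rot k u j = true then (1 : F) else 0) = mono F ({RingSymmetry.shift n k j} : Finset (Fin n)) := by
    funext u
    rw [mono_apply]
    simp [RingSymmetry.rot_eq_comp]
  rw [e]
  exact mono_mem_lowDeg (by simp)

/-- every component of the covariant strategy of a degree-`≤ D` polynomial has degree `≤ D` (composition with a coordinate permutation). -/
theorem covStrat_mem_lowDeg {n D : ℕ} {Q : CubeFn (ZMod 3) n} (hQ : Q ∈ lowDeg (ZMod 3) n D) (b : Fin n) :
    covStrat Q b ∈ lowDeg (ZMod 3) n D :=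
  Smolensky.comp_mem_lowDeg_of_coord (rot b.val) (ind_rot_mem' b.val) hQ

/-- `rot 0 = id`. -/
theorem rot_zero {n : ℕ} (x : Fin n → Bool) : rot 0 x = x := by
  funext b
  simp only [rot, Nat.add_zero]
  congr 1
  exact Fin.ext (Nat.mod_eq_of_lt b.isLt)

/-- rotation amounts only matter mod the ring length. -/
theorem rot_mod (k : ℕ) (y : Fin d → Bool) : rot (k % d) y = rot k y := by
  funext i
  simp only [rot]
  congr 1
  apply Fin.ext
  show (i.val + k % d) % d = (i.val + k) % d
  rw [Nat.add_mod, Nat.mod_mod, ← Nat.add_mod]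

/-- the FOLD of a polynomial along periodization: `foldQ m Q y = Q (per m y)` — substitute `x_b ↦ y_{b mod d}`. -/
def foldQ (m : ℕ) (Q : CubeFn (ZMod 3) (m * d)) : CubeFn (ZMod 3) d := fun y => Q (per m y)

/-- the pull-back of a coordinate indicator of the `m·d`-ring along `per m` is a coordinate indicator of the `d`-ring (degree `≤ 1`). -/
theorem ind_per_mem (b : Fin (m * d)) :
    (fun u : Fin d → Bool => if per m u b = true then (1 : ZMod 3) else 0) ∈ lowDeg (ZMod 3) d 1 := by
  have e : (fun u : Fin d → Bool => if per m u b = true then (1 : ZMod 3) else 0) = mono (ZMod 3) ({b.modNat} : Finset (Fin d)) := by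
    funext u
    rw [mono_apply]
    simp [per_apply]
  rw [e]
  exact mono_mem_lowDeg (by simp)

/-- folding does not raise the degree (`x_S ↦ y_{S mod d}`, tree `comp_mem_lowDeg_of_coord`). -/
theorem foldQ_mem_lowDeg {D : ℕ} {Q : CubeFn (ZMod 3) (m * d)} (hQ : Q ∈ lowDeg (ZMod 3) (m * d) D) :
    foldQ m Q ∈ lowDeg (ZMod 3) d D :=
  Smolensky.comp_mem_lowDeg_of_coord (per m) ind_per_mem hQ

/-- covariant rules commute with periodization: `cov Q (per y) = per (cov (foldQ Q) y)`. -/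
theorem cov_per (Q : CubeFn (ZMod 3) (m * d)) (y : Fin d → Bool) : cov Q (per m y) = per m (cov (foldQ m Q) y) := by
  funext b
  simp only [cov, per_apply, foldQ, rot_per, Fin.coe_modNat, rot_mod]

/-- `perfectCov n`: the set of polynomials `Q` whose covariant rule wins on EVERY odd-class pattern of the `n`-ring. -/
def perfectCov (n : ℕ) : Set (CubeFn (ZMod 3) n) := {Q | ∀ x : Fin n → Bool, OddZeros x → Rel x (cov Q x)}

/-- membership in `perfectCov` (definitional). -/
theorem mem_perfectCov {n : ℕ} (Q : CubeFn (ZMod 3) n) : Q ∈ perfectCov n ↔ ∀ x : Fin n → Bool, OddZeros x → Rel x (cov Q x) :=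
  Iff.rfl

/-- **DESCENT OF PERFECTION** (`m` odd, `d ≥ 3`): a perfect covariant rule on the `m·d`-ring FOLDS to a perfect covariant rule on
the `d`-ring (no degree hypothesis; the fold has the same degree by `foldQ_mem_lowDeg`). -/
theorem covPerfect_fold (hm : Odd m) (hd : 3 ≤ d) {Q : CubeFn (ZMod 3) (m * d)} (h : Q ∈ perfectCov (m * d)) :
    foldQ m Q ∈ perfectCov d := by
  rw [mem_perfectCov] at h ⊢
  intro y hy
  have hR := h (per m y) ((oddZeros_per_iff hm y).mpr hy)
  rwa [cov_per, rel_per_per_iff hm hd hy] at hR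

/-- descent with the degree bookkeeping: a perfect covariant degree-`≤ D` rule on the `m·d`-ring yields one on the `d`-ring. -/
theorem covPerfect_descends (hm : Odd m) (hd : 3 ≤ d) {D : ℕ}
    (h : ∃ Q : CubeFn (ZMod 3) (m * d), Q ∈ lowDeg (ZMod 3) (m * d) D ∧ Q ∈ perfectCov (m * d)) :
    ∃ Q' : CubeFn (ZMod 3) d, Q' ∈ lowDeg (ZMod 3) d D ∧ Q' ∈ perfectCov d := by
  obtain ⟨Q, hQ, hP⟩ := h
  exact ⟨foldQ m Q, foldQ_mem_lowDeg hQ, covPerfect_fold hm hd hP⟩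

/-- `covLosing D`: the set of ring lengths `n` at which NO covariant rule of degree `≤ D` is perfect on the odd class (every such rule is
defeated by some odd-class pattern). -/
def covLosing (D : ℕ) : Set ℕ :=
  {n | ∀ Q : CubeFn (ZMod 3) n, Q ∈ lowDeg (ZMod 3) n D → ∃ x : Fin n → Bool, OddZeros x ∧ ¬ Rel x (cov Q x)}

/-- membership in `covLosing` (definitional). -/
theorem mem_covLosing (D n : ℕ) :
    n ∈ covLosing D ↔ ∀ Q : CubeFn (ZMod 3) n, Q ∈ lowDeg (ZMod 3) n D → ∃ x : Fin n → Bool, OddZeros x ∧ ¬ Rel x (cov Q x) :=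
  Iff.rfl

/-- **FOLD AMPLIFIER** (contrapositive of the descent): no perfect covariant degree-`≤ D` rule at length `d ≥ 3` ⟹ none at ANY length
`m·d` with `m` odd — one finite UNSAT certifies an infinite arithmetic family of lengths. -/
theorem covNotPerfectAt_mul (hm : Odd m) (hd : 3 ≤ d) {D : ℕ} (h : d ∈ covLosing D) : m * d ∈ covLosing D := by
  rw [mem_covLosing] at h ⊢
  intro Q hQ
  obtain ⟨y, hy, hn⟩ := h (foldQ m Q) (foldQ_mem_lowDeg hQ)
  exact ⟨per m y, (oddZeros_per_iff hm y).mpr hy, fun hR => hn (by rwa [cov_per, rel_per_per_iff hm hd hy] at hR)⟩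

/-- `usablePeriods n₀ n`: the USABLE PERIODS of the length `n` above the threshold `n₀` — proper divisors `d` of ODD index `m = n/d` with
`d ≥ max(n₀, 3)`.  `n` is FOLD-REDUCIBLE above `n₀` iff this set is nonempty (for `n ≥ 3n₀`: iff `n ≥ p·max(n₀,3)` for the least odd prime
`p ∣ n`); the fold-IRREDUCIBLE lengths — powers of `2` and `n < p·max(n₀,3)` — have density `0` (but contain every prime). -/
def usablePeriods (n₀ n : ℕ) : Set ℕ := {d | ∃ m : ℕ, n = m * d ∧ Odd m ∧ n₀ ≤ d ∧ 3 ≤ d ∧ d < n}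

/-- membership in `usablePeriods` (definitional). -/
theorem mem_usablePeriods (n₀ n d : ℕ) : d ∈ usablePeriods n₀ n ↔ ∃ m : ℕ, n = m * d ∧ Odd m ∧ n₀ ≤ d ∧ 3 ≤ d ∧ d < n := Iff.rfl

/-- **REDUCTION TO FOLD-IRREDUCIBLE LENGTHS (PROVED, every degree `D`)**: by strong induction along the fold amplifier, covariant
non-perfection at all large lengths follows from covariant non-perfection at the (density-`0`) fold-irreducible lengths. -/
theorem covNotPerfect_iff_irr (D : ℕ) :
    (∃ n₀ : ℕ, ∀ n ≥ n₀, n ∈ covLosing D) ↔ (∃ n₀ : ℕ, ∀ n ≥ n₀, (∀ d, d ∉ usablePeriods n₀ n) → n ∈ covLosing D) := by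
  constructor
  · rintro ⟨n₀, h⟩
    exact ⟨n₀, fun n hn _ => h n hn⟩
  · rintro ⟨n₀, h⟩
    refine ⟨n₀, fun n => ?_⟩
    induction n using Nat.strong_induction_on with
    | _ n ih =>
      intro hn
      by_cases hred : ∃ d, d ∈ usablePeriods n₀ n
      · obtain ⟨d, m, rfl, hm, hd₀, hd3, hdn⟩ := hred
        exact covNotPerfectAt_mul hm hd3 (ih d hdn hd₀)
      · push Not at hred
        exact h n hn hred

/-! ### §3b Periodic (`d`-EQUIVARIANT) strategies fold too: WLOG the strategy is APERIODIC -/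

/-- rotating a pattern of the `d`-ring by `d` does nothing. -/
theorem rot_self (y : Fin d → Bool) : rot d y = y := by
  funext i
  simp only [rot, Nat.add_mod_right]
  congr 1
  exact Fin.ext (Nat.mod_eq_of_lt i.isLt)

/-- a `d`-EQUIVARIANT (period-`d` translation-invariant) strategy: shifting the output index by `d` = rotating the input by `d`,
`P_{b+d}(x) = P_b(rot_d x)` (tree `RingSymmetry.shift`).  Covariant rules are `d`-equivariant for EVERY `d`; uniform circuit families of
period `d` are `d`-equivariant. -/
def equivariant (d n : ℕ) : Set (Fin n → CubeFn (ZMod 3) n) :=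
  {P | ∀ (b : Fin n) (x : Fin n → Bool), P (RingSymmetry.shift n d b) x = P b (rot d x)}

/-- membership in `equivariant` (definitional). -/
theorem mem_equivariant (d : ℕ) {n : ℕ} (P : Fin n → CubeFn (ZMod 3) n) :
    P ∈ equivariant d n ↔ ∀ (b : Fin n) (x : Fin n → Bool), P (RingSymmetry.shift n d b) x = P b (rot d x) := Iff.rfl

/-- re-association of a double shift modulo `n`. -/
theorem mod_shuffle (a b c n : ℕ) : (a + (b + c) % n) % n = ((a + b) % n + c) % n := by
  have h1 : (a + (b + c) % n) % n = (a + (b + c)) % n := by rw [Nat.add_mod, Nat.mod_mod, ← Nat.add_mod]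
  have h2 : ((a + b) % n + c) % n = ((a + b) + c) % n := by rw [Nat.add_mod, Nat.mod_mod, ← Nat.add_mod]
  rw [h1, h2, Nat.add_assoc]

/-- covariant strategies are `d`-equivariant for every `d`. -/
theorem covStrat_equivariant (d : ℕ) {n : ℕ} (Q : CubeFn (ZMod 3) n) : covStrat Q ∈ equivariant d n := by
  rw [mem_equivariant]
  intro b x
  simp only [covStrat, RingSymmetry.shift]
  congr 1
  funext i
  simp only [rot]
  congr 1
  apply Fin.ext
  exact mod_shuffle i.val b.val d n

/-- the position after the block `(c, ·)` of the `m·d`-ring is the block `(c+1, ·)`: `(c,i) + d = (c+1,i)`. -/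
theorem finProdFinEquiv_succ {c : ℕ} (hc : c + 1 < m) (i : Fin d) :
    finProdFinEquiv (⟨c + 1, hc⟩, i) = RingSymmetry.shift (m * d) d (finProdFinEquiv ((⟨c, by omega⟩ : Fin m), i)) := by
  apply Fin.ext
  simp only [finProdFinEquiv, Equiv.coe_fn_mk, RingSymmetry.shift]
  have hi := i.isLt
  have hlt : i.val + d * c + d < m * d := by
    have h1 : d * (c + 2) ≤ d * m := Nat.mul_le_mul_left d (by omega)
    have h2 : i.val + d * c + d < d * (c + 2) := by nlinarith
    calc i.val + d * c + d < d * (c + 2) := h2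
      _ ≤ d * m := h1
      _ = m * d := Nat.mul_comm d m
  rw [Nat.mod_eq_of_lt hlt]
  ring

/-- on a PERIODIC pattern a `d`-equivariant strategy's output depends only on the output index mod `d`. -/
theorem eqv_per_const {P : Fin (m * d) → CubeFn (ZMod 3) (m * d)} (hP : P ∈ equivariant d (m * d)) (y : Fin d → Bool) :
    ∀ (c : ℕ) (hc : c < m) (i : Fin d),
      P (finProdFinEquiv (⟨c, hc⟩, i)) (per m y) = P (finProdFinEquiv (⟨0, by omega⟩, i)) (per m y)
  | 0, _, _ => rfl
  | c + 1, hc, i => by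
    rw [finProdFinEquiv_succ hc i, (mem_equivariant d P).mp hP, rot_per, rot_self]
    exact eqv_per_const hP y c (by omega) i

/-- the FOLDED strategy of a `d`-equivariant strategy (needs `m ≥ 1`): `d` polynomials of the same degree on the `d`-ring. -/
def foldStrat (hm : 1 ≤ m) (P : Fin (m * d) → CubeFn (ZMod 3) (m * d)) : Fin d → CubeFn (ZMod 3) d :=
  fun i => foldQ m (P (finProdFinEquiv (⟨0, hm⟩, i)))

/-- the folded strategy has the same degree bound. -/
theorem foldStrat_mem_lowDeg (hm : 1 ≤ m) {D : ℕ} {P : Fin (m * d) → CubeFn (ZMod 3) (m * d)}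
    (hP : ∀ b, P b ∈ lowDeg (ZMod 3) (m * d) D) (i : Fin d) : foldStrat hm P i ∈ lowDeg (ZMod 3) d D :=
  foldQ_mem_lowDeg (hP _)

/-- on a periodic pattern the output string of a `d`-equivariant strategy is the periodization of the folded strategy's output. -/
theorem eqv_output_per (hm : 1 ≤ m) {P : Fin (m * d) → CubeFn (ZMod 3) (m * d)} (hP : P ∈ equivariant d (m * d)) (y : Fin d → Bool) :
    (fun b => decide (P b (per m y) = 1)) = per m (fun i => decide (foldStrat hm P i y = 1)) := by
  funext b
  rw [per_apply]
  simp only [foldStrat, foldQ]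
  have hb : b = finProdFinEquiv (b.divNat, b.modNat) := by
    rw [← finProdFinEquiv_symm_apply, Equiv.apply_symm_apply]
  conv_lhs => rw [hb]
  rw [show (b.divNat, b.modNat) = ((⟨b.divNat.val, b.divNat.isLt⟩ : Fin m), b.modNat) from rfl,
    eqv_per_const hP y b.divNat.val b.divNat.isLt b.modNat]
  rfl

/-- `losing D`: the set of ring lengths `n` at which EVERY strategy of degree `≤ D` loses on some odd-class pattern (the length-`n` slice of
ExactnessDial's `NoPerfectTwo3` for `D = 2`, of `NoPerfectConst3` for general `D`). -/
def losing (D : ℕ) : Set ℕ :=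
  {n | ∀ P : Fin n → CubeFn (ZMod 3) n, (∀ i, P i ∈ lowDeg (ZMod 3) n D) →
    ∃ x : Fin n → Bool, OddZeros x ∧ ¬ Rel x (fun i => decide (P i x = 1))}

/-- membership in `losing` (definitional). -/
theorem mem_losing (D n : ℕ) :
    n ∈ losing D ↔ ∀ P : Fin n → CubeFn (ZMod 3) n, (∀ i, P i ∈ lowDeg (ZMod 3) n D) →
      ∃ x : Fin n → Bool, OddZeros x ∧ ¬ Rel x (fun i => decide (P i x = 1)) := Iff.rfl

/-- **EQUIVARIANT FOLD (PROVED)**: if every degree-`≤ D` strategy loses somewhere on the odd class of the `d`-ring (`d ≥ 3`), then so does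
every `d`-EQUIVARIANT degree-`≤ D` strategy on the `m·d`-ring, `m` odd — on a PERIODIC pattern. -/
theorem notPerfect_eqv_mul (hm : Odd m) (hd : 3 ≤ d) {D : ℕ} (h : d ∈ losing D)
    (P : Fin (m * d) → CubeFn (ZMod 3) (m * d)) (hP : ∀ b, P b ∈ lowDeg (ZMod 3) (m * d) D) (hE : P ∈ equivariant d (m * d)) :
    ∃ x : Fin (m * d) → Bool, OddZeros x ∧ ¬ Rel x (fun b => decide (P b x = 1)) := by
  have hm1 : 1 ≤ m := one_le_of_odd hm
  obtain ⟨y, hy, hn⟩ := (mem_losing D d).mp h (foldStrat hm1 P) (foldStrat_mem_lowDeg hm1 hP)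
  refine ⟨per m y, (oddZeros_per_iff hm y).mpr hy, fun hR => hn ?_⟩
  rwa [eqv_output_per hm1 hE, rel_per_per_iff hm hd hy] at hR


/-- **LAW «WLOG APERIODIC» (PROVED, every degree `D`)**: by strong induction along the equivariant fold, it suffices to defeat the
strategies with no usable period; every periodic strategy is defeated on a periodic pattern inherited from a shorter ring. -/
theorem notPerfect_iff_aperiodic (D : ℕ) :
    (∃ n₀ : ℕ, ∀ n ≥ n₀, n ∈ losing D) ↔
    (∃ n₀ : ℕ, ∀ n ≥ n₀, ∀ P : Fin n → CubeFn (ZMod 3) n, (∀ i, P i ∈ lowDeg (ZMod 3) n D) →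
      (∀ d ∈ usablePeriods n₀ n, P ∉ equivariant d n) → ∃ x : Fin n → Bool, OddZeros x ∧ ¬ Rel x (fun i => decide (P i x = 1))) := by
  constructor
  · rintro ⟨n₀, h⟩
    exact ⟨n₀, fun n hn P hP _ => (mem_losing D n).mp (h n hn) P hP⟩
  · rintro ⟨n₀, h⟩
    refine ⟨n₀, fun n => ?_⟩
    induction n using Nat.strong_induction_on with
    | _ n ih =>
      intro hn
      rw [mem_losing]
      intro P hP
      by_cases hper : ∃ d, d ∈ usablePeriods n₀ n ∧ P ∈ equivariant d n
      · obtain ⟨d, ⟨m, rfl, hm, hd₀, hd3, hdn⟩, hE⟩ := hper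
        exact notPerfect_eqv_mul hm hd3 (ih d hdn hd₀) P hP hE
      · push Not at hper
        exact h n hn P hP hper


/-! ### §3c A kernel-checked data point: the 3-ring is perfectly solvable by a covariant rule of degree `0` -/

/-- CERTIFICATE (`decide`): on the 3-ring the all-ones output is valid on EVERY odd-class pattern — the covariant rule of the constant
polynomial `Q = 1` is perfect; so `3 ∉ covLosing D` for every `D` and `d = 3` can never be a fold base (census: perfect
covariant QUADRATIC rules exist at every `N = 3,…,9`; the first candidate fold base is `d* ≥ 10`). -/
theorem allOnes_perfect_three : ∀ x : Fin 3 → Bool, OddZeros x → Rel x (fun _ => true) := by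
  unfold OddZeros RingHLF.Rel
  decide

/-- the constant polynomial `1` gives a perfect covariant rule on the 3-ring. -/
theorem covPerfect_one_three : (fun _ : Fin 3 → Bool => (1 : ZMod 3)) ∈ perfectCov 3 := by
  rw [mem_perfectCov]
  intro x hx
  have h := allOnes_perfect_three x hx
  have he : cov (fun _ : Fin 3 → Bool => (1 : ZMod 3)) x = fun _ => true := by
    funext b
    simp [cov]
  rwa [he]

/-- hence `3` is never a fold base: it is false that no covariant degree-`≤ D` rule is perfect on the 3-ring. -/
theorem not_covNotPerfectAt_three (D : ℕ) : 3 ∉ covLosing D := by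
  intro h
  obtain ⟨x, hx, hR⟩ := (mem_covLosing D 3).mp h (fun _ => (1 : ZMod 3)) (by
    have e : (fun _ : Fin 3 → Bool => (1 : ZMod 3)) = mono (ZMod 3) (∅ : Finset (Fin 3)) := by
      funext u; simp [mono_apply]
    rw [e]; exact mono_mem_lowDeg (by simp))
  exact hR ((mem_perfectCov _).mp covPerfect_one_three x hx)

/-- the fold law read UPWARD on this data point (PROVED): on every `3m`-ring, `m` odd, the all-ones output is valid on every
3-PERIODIC odd-class pattern. -/
theorem allOnes_valid_periodic (hm : Odd m) (y : Fin 3 → Bool) (hy : OddZeros y) : Rel (per m y) (fun _ => true) := by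
  have h := (rel_per_per_iff hm (le_refl 3) hy (fun _ => true)).mpr (allOnes_perfect_three y hy)
  exact h

end Summit.QuantumAdvantage.QuantumAdvantage.Theorems.RingPeriodFold
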